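import Summits.CriticalPhenomena.PercolationContinuityZ3.Theorems.Transplant.SkelPhiConcReachHab
import Summits.CriticalPhenomena.PercolationContinuityZ3.Theorems.Transplant.SkelPhiWinChainS
import Summits.CriticalPhenomena.PercolationContinuityZ3.Theorems.Transplant.SkelPhiCellsConcGLevels
import Summits.CriticalPhenomena.PercolationContinuityZ3.Theorems.Transplant.SkelPhiRectAt
import Summits.CriticalPhenomena.PercolationContinuityZ3.Theorems.Transplant.SkelConcReachHab
import HarnessLib

/-!
# Residue (C) of route D″ v2, STRUCTURE-FREE generic layer (DPRIME-SCOPE §2 (C), addendum K; rulings R1–R3 2026-08-21T05:09:29Z): the corridor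
# residue `Skel.ReachOblAtH` of the two-unit concentric scheme `⟨Skelφ.cellGeomSG G φ P t Λ, q, δc⟩` from a window chain over ANY planar
# schedule `Sch : ChainPlanar.Schedule` (p1-g9's `Skelφ.WinChainData`/`PlanarWindow`, `SkelPhiWinChainS`) in the FRESH HABITAT
# `Ω = E^{α}_{x,y} ∪ H^{a'}_{y,y+du}` (`Skelφ.habΩ`), given three PLANAR facts of the schedule (first core `⊇ M_y`, regions `⊆ Q_y ∪ H_{y,du}`,
# last core `⊆ M_{y+du} ∩ H_{y,du}`), two DEPTH rooms, the length bound `Sch.N ≤ nmaxC`, and — as hypotheses — the per-step kits, the rim excess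
# and the count; φ-level twin of `Skel.reachOblAtH_concSG` (SkelConcReachHab §4, p5-g4/g5), schedule-generic so that the corridor schedule
# (`ChainPlanar.Corr.schedule`, `KNCells2ChainCorridorS`) or any re-parametrisation (finding F-DP4-1) plugs in through its three room lemmas

builds on p205010 (kernel theorem, internal audit signed; external expert review pending) — nothing in this file uses p205010.
Lane `prim-bschramm`, seat `prim-bschramm-p5` (gen 6; (C) column of the D″ order of battle), helper file (`--supports stmt-CriticalPhenomena-4575 --as helper`).
Dictionary (addendum K): `Φ.VWin/VStair ↦ Skelφ.VWin/VStair G φ`, `Φ.WinIn ↦ Skelφ.WinIn φ`, `hstep : Skelφ.Steps G φ` for the step device,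
`hlip : Skelφ.Lip G φ` for the planar windows and the level geometry; the Φ-free `Skel.ReachOblAtH`, `Skel.isSubbox_Wcor_hab`, `Skel.nmaxC` and the
`KSchA` habitat facts (`root_not_mem_of_fresh`, `finSupp_Wcor`) are IMPORTED, not re-declared.
* §0 (private) `PCells2.exists_adj_of_mem_M_loc`;
* §1 **`Skelφ.reachOblAtH_of_schedule`** (hlip hstep; `WFS2 P Λ`, `φ t = 0`; `Valid₂`, `a' ∈ {α, α+1}`, `du` onward, `du ≠ rev e.2`; ANY `Sch` with
  `hM0 : P.M y ⊆ Sch.core 0`, `hreg : ∀ k ≤ Sch.N, Sch.region k ⊆ P.Q y ∪ P.Hfull y du`, `hlast : Sch.core (Sch.N+1) ⊆ P.M (y+du) ∩ P.Hfull y du`,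
  `hn : Sch.N ≤ Skel.nmaxC`; chain data `Pd : WinChainData V` with `Pd.o = t`, `Pd.Sfin = Sx`, rim parts inside the regions, `Rlev + 1 ≤ Sch.R'`,
  `j₁ ≤ Rlev`; depth rooms `hcolQ/hcolρ/hρM`; `hcount`, `hkits`, `hη`, `hexc` ⟹ `Skel.ReachOblAtH G ⟨cellGeomSG …, q, δc⟩ (faceDataSG …) Δ' δ h e a' du`).
[cite: KozmaNitzan2024, §4 Lemma 12 (pp. 23–25), p. 26 (M_x, H_{v,x}), p. 30 (Step IV), p. 31]
-/

noncomputable section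

open MeasureTheory ProbabilityTheory
open scoped ENNReal Classical

namespace Summit.CriticalPhenomena.PercolationContinuityZ3.Theorems

namespace Transplant

/-! ## §0 A planar supplement -/

namespace PCells2

open Literature.Probability.Percolation Literature.Probability.LatticeModels SimpleGraph Contour
open Literature.Probability.Percolation.KozmaNitzan
open PCells (exists_adj_of_mem_Icc)

/-- `M v` is ≥ 2 wide in direction `0`, so every point of it has a `ℤ²`-neighbour inside (local copy; the public one is hp-8's
`PCells2.exists_adj_of_mem_M` in `SkelPhiConcFaceInnerRoute`, not imported to keep (C) independent of (F)). [folklore] -/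
private theorem exists_adj_of_mem_M_loc (P : PCells2) (v : Site 2) {t : Site 2} (ht : t ∈ P.M v) : ∃ t' ∈ P.M v, (zdGraph 2).Adj t t' :=
  exists_adj_of_mem_Icc 0 (by simp only [Pi.sub_apply, Pi.add_apply, hw_apply]; push_cast; have := P.one_le_r 0; omega) ht

end PCells2

/-! ## §1 The corridor residue from a window chain over any planar schedule, habitat form -/

namespace Skelφ

open Literature.Probability.Percolation Literature.Probability.LatticeModels SimpleGraph GadgetSystem ProbeHistory HSiteScheme Contour KNCells
open KNCells.KSchA KNLevels ChainPlanar
open Literature.Barriers.CriticalPhenomena (graphBall mem_graphBall_self graphBall_mono)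
open BoxProdZ2 (ConcRadiiG)
open Skel (winGraphIn winGraphIn_le nmaxC ReachOblAtH isSubbox_Wcor_hab)

variable {V : Type} [DecidableEq V] {G : SimpleGraph V} [G.LocallyFinite] {φ : V → Site 2}

/-- **THE CORRIDOR RESIDUE OF THE TWO-UNIT SCHEME, HABITAT FORM, OVER ANY PLANAR SCHEDULE** (generic design (D), (C); DPRIME-SCOPE §2 (C)):
`Skel.ReachOblAtH` from the window chain of `Sch` over the fresh habitat `Ω = E^{α}_{x,y} ∪ H^{a'}_{y,y+du}`, three planar facts of `Sch`
(start at `M_y`, regions in `Q_y ∪ H_{y,du}`, end in `M_{y+du} ∩ H_{y,du}`), two depth rooms, `Sch.N ≤ nmaxC`, and — as hypotheses — the per-step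
kit clauses, the rim excess and the count. [cite: KozmaNitzan2024, §4 Lemma 12 (pp. 23–25), p. 30 (Step IV), p. 31] -/
theorem reachOblAtH_of_schedule (hlip : Lip G φ) (hstep : Steps G φ) {P : PCells2} {t : V} {Λ : ConcRadiiG} (hΛ : WFS2 P Λ) (hφ : φ t = 0)
    {q : unitInterval} {δc : ℝ} {h : ProbeHistory V} {e : Site 2 × MDir}
    (hV : (⟨cellGeomSG G φ P t Λ, q, δc⟩ : KSchA V ℕ).Valid₂ G h e) {a' : ℕ}
    (ha' : a' ∈ ({(⟨cellGeomSG G φ P t Λ, q, δc⟩ : KSchA V ℕ).aOf₁ G h e, (⟨cellGeomSG G φ P t Λ, q, δc⟩ : KSchA V ℕ).aOf₁ G h e + 1} : Finset ℕ))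
    {du : MDir} (hdu : du ∈ (⟨cellGeomSG G φ P t Λ, q, δc⟩ : KSchA V ℕ).onward G h (tgt e)) (hdur : du ≠ rev e.2)
    -- the planar schedule and its three rooms, the length bound
    (Sch : Schedule) (hM0 : P.M (tgt e) ⊆ Sch.core 0) (hreg : ∀ k ≤ Sch.N, Sch.region k ⊆ P.Q (tgt e) ∪ P.Hfull (tgt e) du)
    (hlast : Sch.core (Sch.N + 1) ⊆ P.M (tgt e + stepVec du) ∩ P.Hfull (tgt e) du) (hn : Sch.N ≤ nmaxC)
    -- the chain data
    (Pd : WinChainData V) (hPo : Pd.o = t)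
    (hPS : Pd.Sfin = (⟨cellGeomSG G φ P t Λ, q, δc⟩ : KSchA V ℕ).Sx G h e ((⟨cellGeomSG G φ P t Λ, q, δc⟩ : KSchA V ℕ).aOf₁ G h e) a' du)
    (hRim : ∀ k, Pd.Rim k ⊆ (planarWindowIn hlip (habΩ G φ P t (Λ := Λ) q δc h e a' du)).stepD Sch k)
    (hRl : Pd.Rlev + 1 ≤ Sch.R') (hj : Pd.j₁ ≤ Pd.Rlev)
    -- depth rooms: a vertex of the fresh habitat over every planar point of `Q_y ∪ H`; the last target enters `M^{a'}_{y+du}`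
    (hcolQ : 20 * P.rmax * (((tgt e) 0).natAbs + ((tgt e) 1).natAbs) + 44 * P.rmax + 1 ≤
      Λ.rQ ((⟨cellGeomSG G φ P t Λ, q, δc⟩ : KSchA V ℕ).aOf₁ G h e) (tgt e))
    (hcolρ : ∀ ℓ, 20 * P.rmax * (((tgt e) 0).natAbs + ((tgt e) 1).natAbs) + 44 * P.rmax + 1 ≤ Λ.ρ a' (tgt e) du ℓ)
    (hρM : ∀ ℓ, Λ.ρ a' (tgt e) du ℓ + 1 ≤ Λ.rM a' (tgt e + stepVec du))
    -- the analytic inputs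
    {Δ' : ℕ} {δ η : ℝ} (hcount : 1 / (1 - (q : ℝ)) ^ (Δ' * Pd.N) ≤ δ * ((Finset.Icc Pd.j₀ Pd.j₁).card : ℝ))
    (hkits : ∀ k ≤ Sch.N, ∀ j ∈ Finset.Icc Pd.j₀ Pd.j₁, ∃ (σ : SData V) (Sz : Finset V),
      SHyp (Pd.stepL (planarWindowIn hlip (habΩ G φ P t (Λ := Λ) q δc h e a' du)) Sch k) j σ ∧ σ.N ≤ Pd.N ∧
      (1 - (q : ℝ) ^ σ.sB) ^ σ.k ≤ δ ∧ Sz ⊆ (Pd.stepL (planarWindowIn hlip (habΩ G φ P t (Λ := Λ) q δc h e a' du)) Sch k).X j ∧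
      Sz ⊆ (planarWindowIn hlip (habΩ G φ P t (Λ := Λ) q δc h e a' du)).stepD Sch k ∧
      (∀ x ∈ σ.K, ∀ e' ∈ σ.seed x, e' ∉ wireSet (↑Sz : Set V)) ∧ (∀ x ∈ σ.K, σ.face x ⊆ Sz) ∧
      (∀ x ∈ σ.K, 1 - 3 * δ ≤ (prodBernoulli ((⟨cellGeomSG G φ P t Λ, q, δc⟩ : KSchA V ℕ).Wcor G (faceDataSG G φ P t Λ) h e
          ((⟨cellGeomSG G φ P t Λ, q, δc⟩ : KSchA V ℕ).aOf₁ G h e) a' du)).real {ω | ∃ u ∈ σ.face x,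
        1 - δ < (prodBernoulli (pinW ((⟨cellGeomSG G φ P t Λ, q, δc⟩ : KSchA V ℕ).Wcor G (faceDataSG G φ P t Λ) h e
          ((⟨cellGeomSG G φ P t Λ, q, δc⟩ : KSchA V ℕ).aOf₁ G h e) a' du) (wireSet (↑Sz : Set V)) ω)).real
          (⋃ t' ∈ Pd.coreE (planarWindowIn hlip (habΩ G φ P t (Λ := Λ) q δc h e a' du)) Sch k,
            openConnIn (↑((planarWindowIn hlip (habΩ G φ P t (Λ := Λ) q δc h e a' du)).stepD Sch k) : Set V) u t')}))
    (hη : η ≤ δ / 2)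
    (hexc : ∀ k ≤ Sch.N, (prodBernoulli ((⟨cellGeomSG G φ P t Λ, q, δc⟩ : KSchA V ℕ).Wcor G (faceDataSG G φ P t Λ) h e
        ((⟨cellGeomSG G φ P t Λ, q, δc⟩ : KSchA V ℕ).aOf₁ G h e) a' du)).real (⋃ t' ∈ Pd.Rim k, openConn t t') ≤ η) :
    ReachOblAtH G (⟨cellGeomSG G φ P t Λ, q, δc⟩ : KSchA V ℕ) (faceDataSG G φ P t Λ) Δ' δ h e a' du := by
  -- abbreviations
  set S : KSchA V ℕ := ⟨cellGeomSG G φ P t Λ, q, δc⟩ with hSdef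
  set FD := faceDataSG G φ P t Λ with hFDdef
  set α := S.aOf₁ G h e with hαdef
  set y := tgt e with hydef
  set Ω := habΩ G φ P t (Λ := Λ) q δc h e a' du with hΩdef
  set 𝒲 := planarWindowIn hlip Ω with h𝒲def
  have hroot' : S.Γ.root = t := rfl
  have hL := levelGeomSG P t hΛ hlip (Λ := Λ)
  have hQ : QSepGeom G S.Γ := qSepGeomSG P t hlip (Λ := Λ)
  have hSt := stepsGeomSG P t hΛ hstep (Λ := Λ)
  have hEx := exitGeomSG P t hΛ hlip (Λ := Λ)
  have ha'' : a' ∈ S.Γ.anchSet α y := ha'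
  have hle : ∀ i : Fin (Sch.N + 1), (i : ℕ) ≤ Sch.N := fun i => Nat.lt_succ_iff.1 i.2
  have hΩeq : Ω = S.Γ.Ewv α e.1 e.2 ∪ FD.Hfull a' y du := rfl
  have h𝒲W : ∀ Pl : Finset (Site 2), 𝒲.W Pl = WinIn φ Ω Pl := fun Pl => rfl
  -- every region is inside the fresh habitat and inside the habitat `Q_α(y) ∪ E^far`
  have hDΩ : ∀ k, 𝒲.stepD Sch k ⊆ S.Γ.Ewv α e.1 e.2 ∪ FD.Hfull a' y du := fun k v hv => by
    rw [← hΩeq]; exact ((mem_WinIn (φ := φ)).1 hv).1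
  have hDh : ∀ k ≤ Sch.N, 𝒲.stepD Sch k ⊆ S.Γ.Q α y ∪ S.Γ.Efar a' y du := by
    intro k hk v hv
    obtain ⟨hvΩ, hvφ⟩ := (mem_WinIn (φ := φ)).1 hv
    rcases mem_Q_or_Hfull_of_mem_habΩ hdur hvΩ (hreg k hk hvφ) with hvQ | hvH
    · exact Finset.mem_union_left _ hvQ
    · exact hSt.Hfull_subset _ _ _ _ ha'' hvH
  -- the targets are nonempty: a vertex of the fresh habitat above every core point
  have hTne : ∀ k ≤ Sch.N, (𝒲.coreT Sch k).Nonempty := by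
    intro k hk
    obtain ⟨x₀, hx₀⟩ := Sch.core_nonempty (k := k + 1) (by omega)
    have hx₀' : x₀ ∈ P.Q y ∪ P.Hfull y du := hreg k hk (Sch.core_succ_subset_region hk hx₀)
    obtain ⟨g, hg, hφg⟩ := exists_mem_graphBall_φ_eq hstep t x₀
    simp only [hφ, Pi.zero_apply, sub_zero] at hg
    have hnorm := P.norm_le_of_mem_Q_union_Hfull y du hx₀'
    have hn1 : (x₀ 0).natAbs + (x₀ 1).natAbs + 1 ≤ 20 * P.rmax * ((y 0).natAbs + (y 1).natAbs) + 44 * P.rmax + 1 := by omega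
    suffices hgΩ : g ∈ Ω from ⟨g, (mem_WinIn (φ := φ)).2 ⟨hgΩ, by rw [hφg]; exact hx₀⟩⟩
    rcases Finset.mem_union.1 hx₀' with hxQ | hxH
    · -- over the cube: into the span `Q_α(y)` by the step device
      have hxQ' : φ g ∈ P.Q y := by rw [hφg]; exact hxQ
      have hgQ : g ∈ VWin G φ t (P.Q y) (Λ.rQ α y) := mem_VWin_of_zdAdj hstep hg (hn1.trans hcolQ) hxQ' (P.exists_adj_of_mem_Q _ hxQ')
      exact Finset.mem_union_left _ (Finset.mem_union_right _ hgQ)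
    · -- over the corridor: into the staircase span `H` by the step device
      have hxH' : φ g ∈ P.Hfull y du := by rw [hφg]; exact hxH
      obtain ⟨t', ht', hadj⟩ := P.exists_adj_of_mem_Hfull y du hxH'
      have h1 : (x₀ 0).natAbs + (x₀ 1).natAbs + 1 ≤ prof P Λ a' y du t' := by
        unfold prof; exact hn1.trans (hcolρ _)
      have h2 : (x₀ 0).natAbs + (x₀ 1).natAbs + 1 ≤ prof P Λ a' y du (φ g) := by
        unfold prof; exact hn1.trans (hcolρ _)
      have hgH : g ∈ VStair G φ t (P.Hfull y du) (prof P Λ a' y du) := mem_VStair_of_zdAdj hstep hg hxH' ⟨t', ht', hadj, h1⟩ h2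
      exact Finset.mem_union_right _ hgH
  refine ⟨Sch.N, hn, Ω, fun i => Pd.stepA 𝒲 Sch i, fun i => 𝒲.coreT Sch i, η, fun i => ?_, fun i => ?_,
    fun i => Pd.coreT_subset_coreE 𝒲 Sch i, fun i => ?_, hη, fun i => ?_, ?_, ?_⟩
  · rw [WinChainData.stepA_o, hPo]; exact hroot'.symm
  · -- the true targets link the chain
    show 𝒲.coreT Sch (Fin.castSucc i) ⊆ (Pd.stepA 𝒲 Sch i.succ).L.X 0
    have : ((i.succ : Fin (Sch.N + 1)) : ℕ) = (Fin.castSucc i : ℕ) + 1 := by simp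
    rw [show Pd.stepA 𝒲 Sch (i.succ : ℕ) = Pd.stepA 𝒲 Sch ((Fin.castSucc i : ℕ) + 1) by rw [this]]
    exact Pd.coreT_subset_X_zero_succ 𝒲 Sch _
  · -- the kits of step `i`
    refine Pd.kitsAt_stepA 𝒲 Sch hRl hRim (hle i) (hTne i (hle i)) ?_ ?_ ?_ ?_ ?_ hj hcount (hkits i (hle i))
    · exact isSubbox_Wcor_hab hL hQ hSt hV hdu ha'' (hDΩ i) (hDh i (hle i))
    · rw [hPS]; exact finSupp_Wcor
    · -- regions inside the support `Sx`
      intro v hv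
      rw [hPS]
      rcases Finset.mem_union.1 (hDh i (hle i) hv) with hv' | hv'
      · exact Finset.mem_union_left _ (Finset.mem_union_right _ (Finset.mem_union_right _ hv'))
      · exact Finset.mem_union_right _ hv'
    · rw [hPo]; exact root_not_mem_of_fresh hL hQ hV hdu (hDh i (hle i))
    · rw [hPo, hPS]; exact Finset.mem_union_left _ (Finset.mem_union_left _ hV.root_mem)
  · -- the rim excess
    refine le_trans (measureReal_mono ?_ (measure_ne_top _ _)) (hexc i (hle i))
    intro ω hω
    simp only [Set.mem_iUnion, exists_prop] at hω ⊢
    obtain ⟨t', ht', hωt⟩ := hω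
    exact ⟨t', Pd.coreE_sdiff_subset 𝒲 Sch i ht', hωt⟩
  · -- the arrival cube `M_α(y) ⊆ Q_α(y) ⊆ Ω`, footprint in `P.M y ⊆ core 0`
    show S.Γ.M α y ⊆ (Pd.stepA 𝒲 Sch ((0 : Fin (Sch.N + 1)) : ℕ)).L.X 0
    rw [Fin.val_zero]
    show S.Γ.M α y ⊆ (Pd.stepL 𝒲 Sch 0).X 0
    rw [Pd.stepL_X_zero 𝒲 Sch]
    intro v hv
    refine (mem_WinIn (φ := φ)).2 ⟨Finset.mem_union_left _ (Finset.mem_union_right _ (hEx.M_subset_Q α y hv)), hM0 ?_⟩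
    change v ∈ VWin G φ t (P.M y) (Λ.rM α y) at hv
    exact φ_mem_of_mem_VWin hv
  · -- the last true target enters `M^{a'}_{y+du}` by the step device
    show 𝒲.coreT Sch ((Fin.last Sch.N : Fin _) : ℕ) ⊆ S.Γ.M a' (y + stepVec du)
    rw [Fin.val_last]
    intro v hv
    obtain ⟨hvΩ, hvφ⟩ := (mem_WinIn (φ := φ)).1 hv
    obtain ⟨hvM, hvH⟩ := Finset.mem_inter.1 (hlast hvφ)
    have hcase := mem_Q_or_Hfull_of_mem_habΩ hdur hvΩ (Finset.mem_union_right _ hvH)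
    change v ∈ VWin G φ t (P.M (y + stepVec du)) (Λ.rM a' (y + stepVec du))
    rcases hcase with hvQ | hvHs
    · -- footprint in `P.Q y` and in `P.M (y+du) ⊆ P.Q (y+du)`: impossible
      have h1 : φ v ∈ P.Q y := φ_mem_of_mem_VWin hvQ
      have h2 : φ v ∈ P.Q (y + stepVec du) := P.M_subset_Q _ hvM
      have hne : y ≠ y + stepVec du := fun h' => by
        have h3 := congrArg (fun z => z du.1) h'
        simp only [Pi.add_apply, Literature.Probability.Percolation.KozmaNitzan.Cells.stepVec_apply_fst] at h3
        rcases Literature.Probability.Percolation.KozmaNitzan.Cells.sgOf_sign du with hs | hs <;> rw [hs] at h3 <;> linarith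
      exact absurd h2 (Finset.disjoint_left.1 (P.Q_disjoint_Q hne) h1)
    · obtain ⟨_, hd⟩ := mem_of_mem_VStair hvHs
      exact mem_VWin_of_zdAdj hstep hd (hρM _) hvM (PCells2.exists_adj_of_mem_M_loc P _ hvM)

end Skelφ

end Transplant

end Summit.CriticalPhenomena.PercolationContinuityZ3.Theorems

end
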